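import Summits.ResolutionOfSingularities.ResolutionOfSingularities.Theorems.PurelyInseparableDim4ScopeTreeCert
import HarnessLib

/-!
# Branching in-scope certificates, v2 ‖ K: witnesses that are COMBINATIONS `Σ cₖ x^{eₖ} · D^{(αₖ)}F` of the
# generators of `J_q⁺(F)`, with an explicit certificate tree (cell `res-dim4-pi`, seat res-dim4-p-4 g2)

[OURS · counted 0 · instrument.  Extends `…ScopeTreeCert` (`LoopC.scopeTreeB`: at a forced set `T` some single
generator `D^{(α)}F` reduces modulo `(x_T)` to `x^m · U`, `U(0) ≠ 0`).  At `(p,q) = (3,3)` about one located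
R_OD-global cycle state in ten needs a two-generator step — e.g. `F = x₂x₃³x₄ + x₂²x₄ + x₁³x₂²x₄` (eng-w4 g2
j318944 root S2a-538): after `x₄` is forced by `D^{(0,2,0,0)}F = x₄(1 + x₁³)`, the generators
`g₁ = D^{(0,1,0,1)}F = x₃³ − x₂(1+x₁)³` and `g₂ = D^{(0,0,0,1)}F = x₂x₃³ + x₂²(1+x₁)³` have no unit-monomial
shape one at a time, but `g₂ − x₂·g₁ = 2x₂²(1+x₁)³` forces `x₂`, and then `g₁ ≡ x₃³` forces `x₃`.  Nothing
here is a statement about resolution of singularities in dimension `≥ 4` / characteristic `p`.]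

THE FORMAT: a certificate is a list of entries `(T, W, m)` — at the forced set `T` use the combination
`W = [(αₖ, eₖ, cₖ)]` (each `0 < |αₖ| < q`), whose value `Σ cₖ x^{eₖ} D^{(αₖ)}F ∈ J_q⁺(F)` must reduce modulo
`(x_T)` to `x^m · U` with `U(0) ≠ 0`; the checker `scopeCombTreeB` then recurses into `T ∪ {i}` for every
`xᵢ ∣ x^m`, accepting at `LoopC.leafB` (§2); soundness `inCoordinateScope_of_scopeCombTreeB` (§3) by the
argument of `…ScopeTreeCert` with `evalT (combL L W) ∈ P` in place of the single generator (§1: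
`smulT`, `combL`).  The search for `W` is done off-tree (seat tool `comb33.py`: pairs `g_a + c·x^t·g_b`,
`|t| ≤ 2`, suffice for every located `(3,3)` cycle state of j318944); the kernel only checks.
bears_on: LADDER-RESOLUTION:D157-DOOR2 (res-dim4-pi · F4-C scope certificates · instrument).
Supports stmt-ResolutionOfSingularities-16155 (helper).
-/

set_option linter.dupNamespace false -- mandated namespace of this single-conjunct summit

noncomputable section

open MvPolynomial Finset
open scoped BigOperators

namespace Summit.ResolutionOfSingularities.ResolutionOfSingularities.Theorems.PIDim4

namespace LoopC

open StepKit ScopeCover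
open Literature.AlgebraicGeometry.Resolution
open Literature.AlgebraicGeometry.Resolution.CentreBlowup

variable {K : Type} [Field K] [DecidableEq K]

/-! ## §1 Term multiples and combinations of generators -/

/-- Multiply a term list by the term `c · x^e`. [folklore] -/
def smulT (e : Fin 4 → ℕ) (c : K) (H : Terms 4 K) : Terms 4 K :=
  H.map fun t => (fun i => e i + t.1 i, c * t.2)

omit [DecidableEq K] in
/-- Transfer of `smulT`. [folklore] -/
theorem evalT_smulT (e : Fin 4 → ℕ) (c : K) (H : Terms 4 K) :
    evalT (smulT e c H) = monomial (expo e) c * evalT H := by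
  induction H with
  | nil => simp [smulT]
  | cons t H ih =>
    simp only [smulT, List.map_cons, evalT_cons] at ih ⊢
    have hexp : expo (fun i => e i + t.1 i) = expo e + expo t.1 :=
      Finsupp.ext fun i => by rw [Finsupp.add_apply]; rfl
    rw [ih, mul_add, monomial_mul, hexp]

/-- A combination datum `(α, e, c)` stands for `c · x^e · D^{(α)}F`; `combL` presents the sum over a list. [folklore] -/
def combL (L : Terms 4 K) : List ((Fin 4 → ℕ) × (Fin 4 → ℕ) × K) → Terms 4 K
  | [] => []
  | w :: W => smulT w.2.1 w.2.2 (hasseL w.1 L) ++ combL L W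

omit [DecidableEq K] in
/-- **A combination of generators lies in every ideal containing `J_q⁺(F)`** (all `0 < |αₖ| < q`). [folklore] -/
theorem evalT_combL_mem {q : ℕ} {L : Terms 4 K} {P : Ideal (MvPolynomial (Fin 4) K)}
    (hJP : singLocusIdeal q (evalT L) ≤ P) :
    ∀ W : List ((Fin 4 → ℕ) × (Fin 4 → ℕ) × K), (∀ w ∈ W, 0 < ∑ i, w.1 i ∧ ∑ i, w.1 i < q) →
      evalT (combL L W) ∈ P
  | [], _ => by simp [combL]
  | w :: W, h => by
    rw [combL, evalT_append, evalT_smulT]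
    refine P.add_mem (P.mul_mem_left _ ?_)
      (evalT_combL_mem hJP W fun w' hw' => h w' (List.mem_cons_of_mem _ hw'))
    obtain ⟨h0, hq⟩ := h w (by simp)
    refine hJP (Ideal.subset_span ⟨expo w.1, ?_, ?_, ?_⟩)
    · rw [degree_expo]; exact h0
    · rw [degree_expo]; exact hq
    · rw [← hasseDeriv_evalT]

/-! ## §2 The checker -/

/-- Collecting terms: one term per live exponent (the checker verifies the collection by `StepKit.equivB`, so
no general correctness lemma is needed). [folklore] -/
def normT (H : Terms 4 K) : Terms 4 K := (live H).dedup.map fun e => (e, coeffAt H e)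

/-- **Combination witness** at the forced set `T`: every `αₖ` has `0 < |αₖ| < q`, and modulo `(x_T)` the
combination — with its terms COLLECTED (cancellations happen only in the sum) — is `x^m · U` with
`U(0) ≠ 0`. [folklore] -/
def combWitnessB (q : ℕ) (L : Terms 4 K) (T : Finset (Fin 4))
    (W : List ((Fin 4 → ℕ) × (Fin 4 → ℕ) × K)) (m : Fin 4 → ℕ) : Bool :=
  (W.all fun w => decide (0 < ∑ i, w.1 i) && decide (∑ i, w.1 i < q)) &&
    StepKit.equivB (normT (redT T (combL L W))) (redT T (combL L W)) &&
    ((normT (redT T (combL L W))).all fun t => decide (t.2 = 0) || decide (∀ i, m i ≤ t.1 i)) &&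
    !decide (coeffAt (normT (redT T (combL L W))) m = 0)

/-- A certificate: entries `(T, W, m)` = «at forced set `T`, use combination `W` with monomial `x^m`». [folklore] -/
abbrev ScopeCombCert (K : Type) : Type :=
  List (Finset (Fin 4) × List ((Fin 4 → ℕ) × (Fin 4 → ℕ) × K) × (Fin 4 → ℕ))

/-- **The v2 checker**: at `T` accept at a leaf (`LoopC.leafB`), else use an entry of the certificate keyed by
`T` whose combination witness passes, and recurse into `T ∪ {i}` for every `xᵢ ∣ x^m`. [folklore] -/
def scopeCombTreeB (q : ℕ) (L : Terms 4 K) (cert : ScopeCombCert K) : ℕ → Finset (Fin 4) → Bool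
  | 0, T => leafB q L T
  | fuel + 1, T => leafB q L T ||
      cert.any fun e => decide (e.1 = T) && combWitnessB q L T e.2.1 e.2.2 &&
        decide (∀ i, 0 < e.2.2 i → scopeCombTreeB q L cert fuel (insert i T) = true)

/-! ## §3 Soundness -/

/-- **A combination witness at `T ⊆ {i | xᵢ ∈ P}` puts a variable of `x^m` into `P`.** [folklore] -/
theorem exists_X_mem_of_combWitnessB {q : ℕ} {L : Terms 4 K} {T : Finset (Fin 4)}
    {W : List ((Fin 4 → ℕ) × (Fin 4 → ℕ) × K)} {m : Fin 4 → ℕ}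
    (hw : combWitnessB q L T W m = true) {P : Ideal (MvPolynomial (Fin 4) K)} (hP : P.IsPrime)
    (hJP : singLocusIdeal q (evalT L) ≤ P) (hP0 : P ≤ originIdeal K)
    (hT : ∀ i ∈ T, (X i : MvPolynomial (Fin 4) K) ∈ P) :
    ∃ i, 0 < m i ∧ (X i : MvPolynomial (Fin 4) K) ∈ P := by
  classical
  simp only [combWitnessB, Bool.and_eq_true, decide_eq_true_eq, List.all_eq_true, Bool.or_eq_true,
    Bool.not_eq_true', decide_eq_false_iff_not] at hw
  obtain ⟨⟨⟨hαs, heqv⟩, hdiv⟩, hunit⟩ := hw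
  set H := normT (redT T (combL L W)) with hH
  have hG : evalT (combL L W) ∈ P := evalT_combL_mem hJP W fun w hw => hαs w hw
  have hR : evalT H ∈ P := by
    rw [hH, (evalT_eq_iff_equivB _ _).mpr heqv]
    exact evalT_redT_mem hT hG
  rw [evalT_eq_monomial_mul_downL hdiv] at hR
  rcases hP.mem_or_mem hR with hm | hU
  · have hspan := monomial_mem_span_varsOf hP hP0 hm
    obtain ⟨i, hi, hmi⟩ := MvPolynomial.mem_ideal_span_X_image.mp hspan (expo m)
      (by rw [MvPolynomial.mem_support_iff, coeff_monomial, if_pos rfl]; exact one_ne_zero)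
    exact ⟨i, Nat.pos_of_ne_zero hmi, hi⟩
  · exfalso
    have hU0 : evalT (downL m H) ∈ originIdeal K := hP0 hU
    rw [IsolationCert.originIdeal_eq_idealOfVars,
      Literature.RingTheory.MvPolynomial.mem_idealOfVars_iff_constantCoeff_eq_zero] at hU0
    apply hunit
    rw [← coeffAt_downL_zero hdiv, ← Finsupp.coe_zero, ← coeff_evalT]
    exact hU0

/-- **Soundness of the v2 checker at every forced set.** [folklore] -/
theorem singLocusIdeal_le_of_scopeCombTreeB {q : ℕ} {L : Terms 4 K} {cert : ScopeCombCert K}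
    {P : Ideal (MvPolynomial (Fin 4) K)}
    (hP : P.IsPrime) (hJP : singLocusIdeal q (evalT L) ≤ P) (hP0 : P ≤ originIdeal K) :
    ∀ (fuel : ℕ) (T : Finset (Fin 4)), (∀ i ∈ T, (X i : MvPolynomial (Fin 4) K) ∈ P) →
      scopeCombTreeB q L cert fuel T = true →
      singLocusIdeal q (evalT L) ≤ Ideal.span ((fun i => (X i : MvPolynomial (Fin 4) K)) '' varsOf P) := by
  classical
  have leaf : ∀ T : Finset (Fin 4), (∀ i ∈ T, (X i : MvPolynomial (Fin 4) K) ∈ P) → leafB q L T = true →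
      singLocusIdeal q (evalT L) ≤ Ideal.span ((fun i => (X i : MvPolynomial (Fin 4) K)) '' varsOf P) := by
    intro T hT h
    refine le_trans (singLocusIdeal_le_span_of_leafB h) (Ideal.span_mono (Set.image_mono fun i hi => ?_))
    exact hT i (Finset.mem_coe.mp hi)
  intro fuel
  induction fuel with
  | zero => intro T hT h; exact leaf T hT h
  | succ fuel ih =>
    intro T hT h
    simp only [scopeCombTreeB, Bool.or_eq_true, List.any_eq_true, Bool.and_eq_true, decide_eq_true_eq] at h
    rcases h with h | ⟨e, -, ⟨-, hw⟩, hkids⟩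
    · exact leaf T hT h
    · obtain ⟨i, hi, hXi⟩ := exists_X_mem_of_combWitnessB hw hP hJP hP0 hT
      refine ih (insert i T) (fun k hk => ?_) (hkids i hi)
      rcases Finset.mem_insert.mp hk with rfl | hk
      · exact hXi
      · exact hT k hk

/-- **Soundness of the v2 checker**: `InCoordinateScope q (evalT L)`. [folklore] -/
theorem inCoordinateScope_of_scopeCombTreeB {q fuel : ℕ} {L : Terms 4 K} {cert : ScopeCombCert K}
    (h : scopeCombTreeB q L cert fuel ∅ = true) : InCoordinateScope q (evalT L) :=
  inCoordinateScope_of_forall_prime fun P hP hJP hP0 =>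
    singLocusIdeal_le_of_scopeCombTreeB hP hJP hP0 fuel ∅ (fun i hi => absurd hi (by simp)) h

/-- The same for a presented state. [folklore] -/
theorem inCoordinateScope_toState_of_scopeCombTreeB {q fuel : ℕ} {s : SData 4 K} {cert : ScopeCombCert K}
    (h : scopeCombTreeB q s.L cert fuel ∅ = true) : InCoordinateScope q s.toState.F :=
  inCoordinateScope_of_scopeCombTreeB h

/-! ## §4 The example of the docstring (over `𝔽₃`, `q = 3`) -/

/-- `F = x₂x₃³x₄ + x₂²x₄ + x₁³x₂²x₄` (eng-w4 g2 j318944, R_OD-global (3,3) cycle of root S2a-538, state 0). [OURS · specimen] -/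
def exS2a538 : Terms 4 (ZMod 3) := [(![0, 1, 3, 1], 1), (![0, 2, 0, 1], 1), (![3, 2, 0, 1], 1)]

/-- Its certificate: force `x₄` by `D^{(0,2,0,0)}F`; at `{x₄}` the combination `D^{(0,0,0,1)}F − x₂·D^{(0,1,0,1)}F
= 2x₂²(1+x₁)³` forces `x₂`; at `{x₂,x₄}` `D^{(0,1,0,1)}F ≡ x₃³` forces `x₃`. [OURS · certificate data] -/
def exS2a538Cert : ScopeCombCert (ZMod 3) :=
  [(∅, [(![0, 2, 0, 0], ![0, 0, 0, 0], 1)], ![0, 0, 0, 1]),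
   ({3}, [(![0, 0, 0, 1], ![0, 0, 0, 0], 1), (![0, 1, 0, 1], ![0, 1, 0, 0], 2)], ![0, 2, 0, 0]),
   ({1, 3}, [(![0, 1, 0, 1], ![0, 0, 0, 0], 1)], ![0, 0, 3, 0])]


/-- The single-generator search does NOT certify this state at depth 4 (census remark, kernel-checked). [OURS · ‖ K] -/
theorem scopeTreeB_exS2a538 : scopeTreeB 3 exS2a538 4 ∅ = false := by decide

/-- … while the combination certificate does. [OURS · ‖ K] -/
theorem scopeCombTreeB_exS2a538 : scopeCombTreeB 3 exS2a538 exS2a538Cert 4 ∅ = true := by decide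

/-- Hence `F` is in coordinate scope at `q = 3`. [OURS · ‖ K] -/
theorem inCoordinateScope_exS2a538 : InCoordinateScope 3 (evalT exS2a538) :=
  inCoordinateScope_of_scopeCombTreeB scopeCombTreeB_exS2a538

end LoopC

end Summit.ResolutionOfSingularities.ResolutionOfSingularities.Theorems.PIDim4

end
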